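import Mathlib
import HarnessLib
import Summits.Ventures.LatticeQCDFlow.Exactness.SphereKickedProduct
import Summits.Ventures.LatticeQCDFlow.Exactness.KickedProductTwoPoint
import Summits.Ventures.LatticeQCDFlow.Exactness.LocalDilationPushforward

/-!
# The `n`-step sphere leapfrog read in the tangent space: the readout `V ↦ P_T(V† x)`, an approximate dilation by `nδ`, and the covering of a tangent ball

HONEST FRAMING: exact (Metropolis-corrected) sampling algorithms for lattice gauge theory;
figures of merit are autocorrelation/cost numbers at stated couplings and volumes; no
continuum-physics claim.

Venture `LatticeQCDFlow` (cell pub-lqcd), topic `Exactness`, FANOUT row 9 (eng-latcore; roadmap Step 2 (a, b, c) to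
multi-step HMC on the `cpn_2d` sphere family, HOME/eng-latcore/HANDOFF.md GEN-19).  NEW WORK of the cell over the
tree (`SphereKickedProduct.lean`: `geodGenNegL`, `opFrame`, `plfBounds_sphere`, `opFrame_bfLeapfrog_iterate`;
`SphereGeodesicExponential.lean`: `geodGen`, `inner_geodGen_symm`; gen-18's `KickedProductTrajectory.lean` /
`KickedProductTwoPoint.lean`: `plfTraj`, `plfStep_iterate_fst`, `plfSmall`, **`plfTraj_fst_approx`**; gen-18's
`LocalDilationPushforward.lean`: `exists_addHaar_image_le_of_lipschitzOnWith`, `addHaar_inter_ball_le_of_approxOn`)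
and Mathlib (`ContinuousLinearMap.adjoint`, `Submodule.orthogonalProjection`); nothing is cited as a fact; no number.

THE POINT.  In the body frame the position after `n` steps from `x` is `W_n x = V_n† x` with `V_n = W_n⁻¹` the
inverse frame of `SphereKickedProduct.lean` (an isometry, so `W_n = V_n†`).  (a) READOUT.  Read it in the tangent
space `T_x = (ℝx)ᗮ` through the orthogonal projection `P_T`: `ℓ(V) = P_T(V† x)` is real-linear and `1`-Lipschitz in
the operator norm (`‖x‖ = 1`), and on the generator it is the identity of `T_x`: `ℓ(J_x v) = P_T(A(x, v) x) = v` for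
`v ⊥ x` (`(−A)† = A`).  Consequently ANY map `Ψ : E → 𝔸` with the two-point property
`‖Ψ p − Ψ p' − τ·J_x(p − p')‖ ≤ c‖p − p'‖` on a ball yields the tangent map `Φ = ℓ ∘ Ψ ∘ ι` with
`‖Φ q − Φ q' − τ(q − q')‖ ≤ c‖q − q'‖`.  (b) DILATION.  With the standing hypotheses discharged for the sphere
(`plfBounds_sphere`: isometries, `C = 1`, half kick `G = bodyKickOp F (δ/2) x` bounded by `b = |δ/2|·b_F` and
Lipschitz with `K = |δ/2|(b_F + K_F)`), gen-18's discrete-Grönwall two-point estimate for the inverse frame `V_n(p)`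
holds VERBATIM, so the tangent map `Φ_n(q) = ℓ(V_n(q))` of the `n`-step leapfrog started at `x` with tangent momentum
`q` satisfies `‖Φ_n q − Φ_n q' − nδ(q − q')‖ ≤ plfSmall·(nδ‖J‖)·‖q − q'‖` on the momentum ball — an APPROXIMATE
DILATION BY THE TRAJECTORY LENGTH, uniformly in `n`.  (c) COVERING.  `T_x` is a finite-dimensional inner product
space with its own additive Haar measure; since `Φ_n` is an approximate dilation by `τ = nδ` with defect
`c = plfSmall·τ‖J_x‖ < τ`, gen-18's covering-and-volume lemma applies ON `T_x`: for every set `B ⊆ T_x`,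
`Leb_T(B ∩ ball 0 r) ≤ (A(τ + c))^{dim T_x} · Leb_T(Φ_n⁻¹ B ∩ closedBall 0 R)` whenever `r + ‖Φ_n 0‖ ≤ (τ − c) R` —
the flat-side half of the position law (the sphere side is the chart comparison of `SphereExpMapLocalChart.lean` /
`SphereExpChartFlatSide.lean`).

* `adjoint_geodGen` (`A† = −A`), `adjoint_geodGenNegL_apply_self` (`(J_x v)† x = v − ⟪x,v⟫x`),
  `sphereReadout x` (+ `_sub`, `_smul`, `norm_sphereReadout_sub_le`, **`sphereReadout_geodGenNegL`**),
  **`sphereReadout_approx`** (two-point property in `𝔸` ⇒ approximate dilation on `T_x`).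
* `sphereInvFrame x F δ n p = (plfTraj exp J_x G δ p n).1` (the inverse frame after `n` steps; `_eq_opFrame`:
  it IS `(opFrame (bfLeapfrog^[n] (refl, p))).1`), `sphereTangentMap` (`Φ_n`),
  **`sphereTangentMap_approx`** (the approximate-dilation inequality under gen-18's smallness conditions
  `n(δ‖J‖(R + (2n+1)b)) ≤ ρ`, `plfSmall J 1 K η δ b R n ≤ 1`).
* **`sphereTangentMap_covers`** — the displayed covering inequality, for any additive Haar measure `μ` on `T_x` and
  the constant `A` of `exists_addHaar_image_le_of_lipschitzOnWith`, under the hypotheses of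
  `sphereTangentMap_approx` plus `plfSmall·(nδ‖J_x‖) < nδ`.

NOT CLAIMED: that `V_n† x` IS the position beyond the frame identities of the previous files (the identification
`W = V†` for isometric `V` is `LinearIsometryEquiv.adjoint_eq_symm`); a bound on `‖Φ_n 0‖` (the drift of the
zero-momentum trajectory under the kicks — gen-18's `norm_plfTraj_fst_sub_one_le` gives `‖V_n(0) − 1‖ ≤ 2nθC`, to be
read out; left as the hypothesis `hr`); the threshold packaging of the smallness conditions (as gen-18's
`SUNMultiStepThreshold`); the chart gluing, the one-update minorisation and the cap chaining (roadmap Steps 3–5);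
families; constants.
-/

noncomputable section

namespace Summit.Ventures.LatticeQCDFlow.Exactness

open NormedSpace Metric Function Set
open scoped InnerProductSpace NNReal

variable {m : Type*} [Fintype m]

/-- **`A(x,p)† = −A(x,p)`**: the generator is skew-adjoint. -/
theorem adjoint_geodGen (x p : EuclideanSpace ℝ m) :
    ContinuousLinearMap.adjoint (geodGen x p) = -geodGen x p := by
  symm
  rw [ContinuousLinearMap.eq_adjoint_iff]
  intro y z
  show ⟪(-geodGen x p) y, z⟫_ℝ = ⟪y, geodGen x p z⟫_ℝ
  have h := inner_geodGen_symm x p y z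
  show ⟪-(geodGen x p y), z⟫_ℝ = ⟪y, geodGen x p z⟫_ℝ
  rw [inner_neg_left, h, neg_neg]

/-- `(J_x v)† x = A(x, v) x = v − ⟪v, x⟫ x` (for unit `x`). -/
theorem adjoint_geodGenNegL_apply_self {x : EuclideanSpace ℝ m} (hx : ‖x‖ = 1) (v : EuclideanSpace ℝ m) :
    ContinuousLinearMap.adjoint (geodGenNegL x v) x = v - ⟪v, x⟫_ℝ • x := by
  rw [geodGenNegL_apply, map_neg, adjoint_geodGen, neg_neg, geodGen_apply, real_inner_self_eq_norm_sq, hx, one_pow,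
    one_smul]

section Readout

variable (x : EuclideanSpace ℝ m)

/-- The tangent space at `x`: `(ℝ x)ᗮ`. -/
abbrev tangentAt : Submodule ℝ (EuclideanSpace ℝ m) := (ℝ ∙ x)ᗮ

/-- **The position readout** `ℓ(V) = P_T(V† x) ∈ T_x`. -/
def sphereReadout (V : EuclideanSpace ℝ m →L[ℝ] EuclideanSpace ℝ m) : tangentAt x :=
  (tangentAt x).orthogonalProjectionOnto (ContinuousLinearMap.adjoint V x)

/-- The readout is additive/real-linear: differences. -/
theorem sphereReadout_sub (V V' : EuclideanSpace ℝ m →L[ℝ] EuclideanSpace ℝ m) :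
    sphereReadout x V - sphereReadout x V' = sphereReadout x (V - V') := by
  unfold sphereReadout
  rw [map_sub (ContinuousLinearMap.adjoint (𝕜 := ℝ) (E := EuclideanSpace ℝ m) (F := EuclideanSpace ℝ m)), ← map_sub]
  rfl

/-- The readout of a scalar multiple. -/
theorem sphereReadout_smul (c : ℝ) (V : EuclideanSpace ℝ m →L[ℝ] EuclideanSpace ℝ m) :
    sphereReadout x (c • V) = c • sphereReadout x V := by
  simp [sphereReadout]

/-- **The readout is `1`-Lipschitz in the operator norm** (`‖x‖ = 1`). -/
theorem norm_sphereReadout_sub_le (hx : ‖x‖ = 1) (V V' : EuclideanSpace ℝ m →L[ℝ] EuclideanSpace ℝ m) :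
    ‖sphereReadout x V - sphereReadout x V'‖ ≤ ‖V - V'‖ := by
  rw [sphereReadout_sub, sphereReadout]
  refine (Submodule.norm_orthogonalProjectionOnto_apply_le _ _).trans ?_
  calc ‖ContinuousLinearMap.adjoint (V - V') x‖ ≤ ‖ContinuousLinearMap.adjoint (V - V')‖ * ‖x‖ :=
        ContinuousLinearMap.le_opNorm _ _
    _ = ‖V - V'‖ := by rw [LinearIsometryEquiv.norm_map, hx, mul_one]

/-- **On the generator the readout is the identity of the tangent space**: `ℓ(J_x v) = v` for `v ∈ T_x`. -/
theorem sphereReadout_geodGenNegL (hx : ‖x‖ = 1) (v : tangentAt x) :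
    sphereReadout x (geodGenNegL x (v : EuclideanSpace ℝ m)) = v := by
  have hv : ⟪(v : EuclideanSpace ℝ m), x⟫_ℝ = 0 := by
    have h := v.2
    rw [Submodule.mem_orthogonal_singleton_iff_inner_right] at h
    rw [real_inner_comm]; exact h
  rw [sphereReadout, adjoint_geodGenNegL_apply_self hx, hv, zero_smul, sub_zero,
    Submodule.orthogonalProjectionOnto_mem_subspace_eq_self]

/-- **TWO-POINT PROPERTY IN THE ALGEBRA ⇒ APPROXIMATE DILATION OF THE TANGENT SPACE.**  If `Ψ : E → 𝔸`
satisfies `‖Ψ p − Ψ p' − τ • J_x (p − p')‖ ≤ c ‖p − p'‖` for `‖p‖, ‖p'‖ ≤ R` (gen-18's `plfTraj_fst_approx`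
for the inverse frame after `n` steps, `τ = nδ`), then `Φ = ℓ ∘ Ψ ∘ ι : T_x → T_x` satisfies
`‖Φ q − Φ q' − τ • (q − q')‖ ≤ c ‖q − q'‖` for `‖q‖, ‖q'‖ ≤ R` (`‖x‖ = 1`). -/
theorem sphereReadout_approx (hx : ‖x‖ = 1) {Ψ : EuclideanSpace ℝ m → (EuclideanSpace ℝ m →L[ℝ] EuclideanSpace ℝ m)}
    {τ c R : ℝ}
    (hΨ : ∀ p p' : EuclideanSpace ℝ m, ‖p‖ ≤ R → ‖p'‖ ≤ R →
      ‖Ψ p - Ψ p' - τ • geodGenNegL x (p - p')‖ ≤ c * ‖p - p'‖)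
    (q q' : tangentAt x) (hq : ‖q‖ ≤ R) (hq' : ‖q'‖ ≤ R) :
    ‖sphereReadout x (Ψ q) - sphereReadout x (Ψ q') - τ • (q - q')‖ ≤ c * ‖q - q'‖ := by
  have hτ : τ • (q - q') = sphereReadout x (τ • geodGenNegL x ((q : EuclideanSpace ℝ m) - (q' : EuclideanSpace ℝ m))) := by
    rw [sphereReadout_smul, ← Submodule.coe_sub, sphereReadout_geodGenNegL x hx (q - q')]
  rw [hτ, sphereReadout_sub, sphereReadout_sub]
  have h := hΨ q q' (by simpa using hq) (by simpa using hq')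
  calc ‖sphereReadout x (Ψ ↑q - Ψ ↑q' - τ • geodGenNegL x (↑q - ↑q'))‖
      = ‖sphereReadout x (Ψ ↑q - Ψ ↑q' - τ • geodGenNegL x (↑q - ↑q')) - sphereReadout x 0‖ := by
          rw [show sphereReadout x 0 = 0 by simp [sphereReadout], sub_zero]
    _ ≤ ‖(Ψ ↑q - Ψ ↑q' - τ • geodGenNegL x (↑q - ↑q')) - 0‖ := norm_sphereReadout_sub_le x hx _ _
    _ ≤ c * ‖q - q'‖ := by rw [sub_zero]; simpa [Submodule.coe_norm, Submodule.coe_sub] using h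

end Readout

section Dilation

variable (x : EuclideanSpace ℝ m) (F : EuclideanSpace ℝ m → EuclideanSpace ℝ m) (δ : ℝ)

/-- **The inverse frame after `n` leapfrog steps** from the identity frame with body momentum `p`, as the
first component of gen-18's half-step trajectory in the operator algebra. -/
def sphereInvFrame (n : ℕ) (p : EuclideanSpace ℝ m) : EuclideanSpace ℝ m →L[ℝ] EuclideanSpace ℝ m :=
  (plfTraj exp (geodGenNegL x) (bodyKickOp F (δ / 2) x) δ p n).1

/-- It IS the inverse frame of the body-frame leapfrog (`opFrame`, `bfLeapfrog`) started at the identity. -/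
theorem sphereInvFrame_eq_opFrame (e : sphere (0 : EuclideanSpace ℝ m) 1) (n : ℕ) (p : EuclideanSpace ℝ m) :
    sphereInvFrame (e : EuclideanSpace ℝ m) F δ n p =
      (opFrame ((bfLeapfrog e F δ)^[n] (LinearIsometryEquiv.refl ℝ (EuclideanSpace ℝ m), p))).1 := by
  rw [opFrame_bfLeapfrog_iterate, plfStep_iterate_fst]
  rfl

/-- **The tangent map** `Φ_n(q) = P_T((V_n(q))† x)`. -/
def sphereTangentMap (n : ℕ) (q : tangentAt x) : tangentAt x :=
  sphereReadout x (sphereInvFrame x F δ n (q : EuclideanSpace ℝ m))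

variable {x F δ} {bF KF ρ η R : ℝ} {n : ℕ}

/-- **THE `n`-STEP SPHERE LEAPFROG IS AN APPROXIMATE DILATION OF THE TANGENT SPACE BY `nδ`** (under gen-18's
smallness conditions with `C = 1`, `b = |δ/2| b_F`, `K = |δ/2|(b_F + K_F)`; `‖x‖ = 1`, `δ ≥ 0`). -/
theorem sphereTangentMap_approx (hx : ‖x‖ = 1) (hFb : ∀ y, ‖F y‖ ≤ bF) (hK0 : 0 ≤ KF)
    (hFK : ∀ y y', ‖F y - F y'‖ ≤ KF * ‖y - y'‖) (hρ0 : 0 < ρ) (hη0 : 0 ≤ η) (hη1 : η ≤ 1)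
    (hdef : ∀ a a' : EuclideanSpace ℝ m →L[ℝ] EuclideanSpace ℝ m, ‖a‖ ≤ ρ → ‖a'‖ ≤ ρ →
      ‖exp a - exp a' - (a - a')‖ ≤ η * ‖a - a'‖)
    (hδ : 0 ≤ δ)
    (hρ : n * (δ * ‖geodGenNegL x‖ * (R + (2 * n + 1) * (|δ / 2| * bF))) ≤ ρ)
    (hS : plfSmall (geodGenNegL x) 1 (|δ / 2| * (bF + KF * ‖x‖)) η δ (|δ / 2| * bF) R n ≤ 1)
    (q q' : tangentAt x) (hq : ‖q‖ ≤ R) (hq' : ‖q'‖ ≤ R) :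
    ‖sphereTangentMap x F δ n q - sphereTangentMap x F δ n q' - ((n : ℝ) * δ) • (q - q')‖ ≤
      plfSmall (geodGenNegL x) 1 (|δ / 2| * (bF + KF * ‖x‖)) η δ (|δ / 2| * bF) R n *
        ((n : ℝ) * δ * ‖geodGenNegL x‖) * ‖q - q'‖ := by
  have hB := plfBounds_sphere (F := F) (c := δ / 2) (e := x) hFb hK0 hFK hρ0 hη0 hη1 hdef
  refine sphereReadout_approx x hx (Ψ := fun p => sphereInvFrame x F δ n p) (fun p p' hp hp' => ?_) q q' hq hq'
  exact plfTraj_fst_approx hB hδ hp hp' hρ hS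

end Dilation

section Pushforward

open MeasureTheory Measure
open scoped ENNReal

/-- **THE `n`-STEP SPHERE LEAPFROG COVERS A TANGENT BALL, WITH A VOLUME BOUND.**  On the tangent space `T_x`
with an additive Haar measure `μ`: if `A` is a Lipschitz-volume constant of `μ` and the smallness conditions of
`sphereTangentMap_approx` hold with `c = plfSmall·(nδ‖J_x‖) < nδ`, then for every `B ⊆ T_x` and radii with
`r + ‖Φ_n 0‖ ≤ (nδ − c) R`:  `μ(B ∩ ball 0 r) ≤ (A(nδ + c))^{dim T_x} · μ(Φ_n⁻¹ B ∩ closedBall 0 R)`. -/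
theorem sphereTangentMap_covers {x : EuclideanSpace ℝ m} {F : EuclideanSpace ℝ m → EuclideanSpace ℝ m}
    {δ bF KF ρ η R r : ℝ} {n : ℕ}
    (μ : Measure (tangentAt x)) [μ.IsAddHaarMeasure] {A : ℝ≥0}
    (hA : ∀ (K : ℝ≥0) (f : tangentAt x → tangentAt x) (s : Set (tangentAt x)), LipschitzOnWith K f s →
      μ (f '' s) ≤ ((A * K : ℝ≥0) : ℝ≥0∞) ^ Module.finrank ℝ (tangentAt x) * μ s)
    (hx : ‖x‖ = 1) (hFb : ∀ y, ‖F y‖ ≤ bF) (hK0 : 0 ≤ KF)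
    (hFK : ∀ y y', ‖F y - F y'‖ ≤ KF * ‖y - y'‖) (hρ0 : 0 < ρ) (hη0 : 0 ≤ η) (hη1 : η ≤ 1)
    (hdef : ∀ a a' : EuclideanSpace ℝ m →L[ℝ] EuclideanSpace ℝ m, ‖a‖ ≤ ρ → ‖a'‖ ≤ ρ →
      ‖exp a - exp a' - (a - a')‖ ≤ η * ‖a - a'‖)
    (hδ : 0 ≤ δ) (hR : 0 ≤ R)
    (hρ : n * (δ * ‖geodGenNegL x‖ * (R + (2 * n + 1) * (|δ / 2| * bF))) ≤ ρ)
    (hS : plfSmall (geodGenNegL x) 1 (|δ / 2| * (bF + KF * ‖x‖)) η δ (|δ / 2| * bF) R n ≤ 1)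
    (hcτ : plfSmall (geodGenNegL x) 1 (|δ / 2| * (bF + KF * ‖x‖)) η δ (|δ / 2| * bF) R n *
        ((n : ℝ) * δ * ‖geodGenNegL x‖) < (n : ℝ) * δ)
    (hr : r + ‖sphereTangentMap x F δ n 0‖ ≤
        ((n : ℝ) * δ - plfSmall (geodGenNegL x) 1 (|δ / 2| * (bF + KF * ‖x‖)) η δ (|δ / 2| * bF) R n *
          ((n : ℝ) * δ * ‖geodGenNegL x‖)) * R)
    (B : Set (tangentAt x)) :
    μ (B ∩ ball 0 r) ≤
      ((A * Real.toNNReal ((n : ℝ) * δ + plfSmall (geodGenNegL x) 1 (|δ / 2| * (bF + KF * ‖x‖)) η δ (|δ / 2| * bF) R n *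
          ((n : ℝ) * δ * ‖geodGenNegL x‖)) : ℝ≥0) : ℝ≥0∞) ^ Module.finrank ℝ (tangentAt x) *
        μ (sphereTangentMap x F δ n ⁻¹' B ∩ closedBall 0 R) := by
  have hc0 : 0 ≤ plfSmall (geodGenNegL x) 1 (|δ / 2| * (bF + KF * ‖x‖)) η δ (|δ / 2| * bF) R n *
      ((n : ℝ) * δ * ‖geodGenNegL x‖) := by
    -- the defect constant is a norm bound: evaluate the approximation inequality? simpler: it is a product of nonnegatives
    have h1 : 0 ≤ plfSmall (geodGenNegL x) 1 (|δ / 2| * (bF + KF * ‖x‖)) η δ (|δ / 2| * bF) R n := by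
      have hb0 : 0 ≤ bF := (norm_nonneg _).trans (hFb 0)
      unfold plfSmall
      positivity
    positivity
  exact addHaar_inter_ball_le_of_approxOn μ hA hcτ hc0 hR
    (fun p hp p' hp' => sphereTangentMap_approx hx hFb hK0 hFK hρ0 hη0 hη1 hdef hδ hρ hS p p'
      (mem_closedBall_zero_iff.1 hp) (mem_closedBall_zero_iff.1 hp')) hr B

end Pushforward

end Summit.Ventures.LatticeQCDFlow.Exactness
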